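import Literature.Topology.FourManifolds.RegularLevelCollar
import Literature.Topology.FourManifolds.RegularSlabField
import Literature.Topology.FourManifolds.MorseProofs
import Literature.Geometry.Manifold.CompactSupportFlow
import Mathlib.Analysis.Calculus.BumpFunction.FiniteDimension
import HarnessLib

/-!
# The product neighbourhood of a regular level with compact band (non-compact manifolds)

Topic `Literature/Topology/FourManifolds`; companion of `RegularLevelCollar.lean` (Milnor, *Morse
theory* (1963), Thm. 3.1; *Lectures on the h-cobordism theorem* (1965), Thm. 3.4:
`f⁻¹(a - δ, a + δ) ≅ f⁻¹(a) × (-δ, δ)`), written for the surface-smoothing programme (the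
`n = 2` leaf of `Literature.Topology.FourManifolds.exists_chartedSpace_isManifold_of_le_three`:
the exotic annulus is not compact, but its proper Morse function has compact bands). The tree's
`RegularLevelCollar.lean` assumes `M` compact, which is used only to make the unit-speed field
complete. Here `M` is a Hausdorff σ-compact manifold without boundary (model `𝓡 (n + 1)`), `f`
is smooth, the level `a` is regular and **some closed band `f⁻¹[a - δ₀, a + δ₀]` is compact**
(e.g. `f` proper). Then:

* `IsRegularLevel.exists_bandUnitField` — there is a `BandUnitField`: a smooth vector field `ξ`
  with `ξ(f) = 1` on a band `f⁻¹[a - δ, a + δ]` and **vanishing off a compact set** (a unit field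
  on a critical-point-free closed band, `exists_contMDiffSection_mlineDeriv_eq_one_on`, cut off
  by a bump function of `f`);
* the global flow of such a field (`Literature.Geometry.Manifold.exists_contMDiff_globalFlow_of_
  eq_zero_off_isCompact`, Lee 2012, Thm. 9.16) and, verbatim from `RegularLevelCollar.lean`, the
  clock `f (fl x t) = f x + t` in the band, the drop onto the level, and **the product chart**
  `BandUnitField.collarChart` from `f⁻¹(a) × (-δ, δ)` onto the open band, `C^∞` with `C^∞`
  inverse, with `f = a + s` in the chart;
* `IsRegularLevel.exists_collarChart_of_isCompact_band` — the conclusion in the form of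
  `IsRegularLevel.exists_collarChart`.

Everything is proved; no named facts are introduced.

## References

* J. Milnor, *Morse theory*, Ann. of Math. Studies 51 (1963), Thm. 3.1 and its proof.
  [Milnor1963]
* J. Milnor, *Lectures on the h-cobordism theorem*, Princeton (1965), Thm. 3.4 and its proof.
  [MilnorHCobordism1965]
* J. M. Lee, *Introduction to Smooth Manifolds*, 2nd ed. (2012), Thm. 9.12, Thm. 9.16.
  [LeeSmoothManifolds2013]
-/

open scoped Manifold ContDiff Topology
open Set Function Filter

noncomputable section

universe u

namespace Literature.Topology.FourManifolds

/-- Local notation: `𝔼 n` is the model Euclidean space `EuclideanSpace ℝ (Fin n)`. -/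
local notation "𝔼 " n:arg => EuclideanSpace ℝ (Fin n)

variable {n : ℕ} {M : Type u} [TopologicalSpace M] [T2Space M]
  [ChartedSpace (𝔼 (n + 1)) M] [IsManifold (𝓡 (n + 1)) ∞ M]

/-! ### Unit-speed fields with compact support -/

/-- A **compactly supported unit-speed field across the level `a`** of `f`: a
`LevelUnitField` (smooth `ξ` with `ξ(f) = 1` on `f⁻¹[a - δ, a + δ]`) which vanishes off a
compact set `K`. [cite: Milnor1963, proof of Thm. 3.1] -/
structure BandUnitField (n : ℕ) {M : Type u} [TopologicalSpace M] [ChartedSpace (𝔼 (n + 1)) M]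
    [IsManifold (𝓡 (n + 1)) ∞ M] (f : M → ℝ) (a : ℝ) extends LevelUnitField n f a where
  /-- The support set. -/
  K : Set M
  /-- It is compact. -/
  isCompact_K : IsCompact K
  /-- The field vanishes off `K`. -/
  eq_zero_off : ∀ x, x ∉ K → ξ x = 0

/-- **A regular level with a compact band carries a compactly supported unit-speed field**: the
critical set is closed and misses the level, so it misses a thinner closed band (compactness);
a unit field on that band (`exists_contMDiffSection_mlineDeriv_eq_one_on`) cut off by a bump
function of `f` supported inside it is the required field. [cite: Milnor1963, proof of Thm. 3.1] -/
theorem IsRegularLevel.exists_bandUnitField [SigmaCompactSpace M] {f : M → ℝ} {a : ℝ}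
    (h : IsRegularLevel (𝓡 (n + 1)) f a) {δ₀ : ℝ} (hδ₀ : 0 < δ₀)
    (hK : IsCompact (f ⁻¹' Icc (a - δ₀) (a + δ₀))) : Nonempty (BandUnitField n f a) := by
  have hf := h.contMDiff
  -- a thinner closed band without critical points
  have hcl : IsClosed (criticalSet (𝓡 (n + 1)) f) := isClosed_criticalSet_of_contMDiff hf (by norm_cast)
  obtain ⟨δ₁, hδ₁, hδ₁₀, hreg⟩ : ∃ δ₁, 0 < δ₁ ∧ δ₁ ≤ δ₀ ∧
      ∀ x, f x ∈ Icc (a - δ₁) (a + δ₁) → mfderiv (𝓡 (n + 1)) 𝓘(ℝ, ℝ) f x ≠ 0 := by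
    set C := criticalSet (𝓡 (n + 1)) f ∩ f ⁻¹' Icc (a - δ₀) (a + δ₀) with hC
    have hCc : IsCompact C := hK.inter_left hcl
    rcases C.eq_empty_or_nonempty with hCe | hCne
    · refine ⟨δ₀, hδ₀, le_rfl, fun x hx hcrit => ?_⟩
      have : x ∈ C := ⟨hcrit, hx⟩
      rw [hCe] at this; exact this
    · -- `|f - a|` attains a positive minimum on `C`
      have hcont : ContinuousOn (fun x => |f x - a|) C :=
        ((hf.continuous.sub continuous_const).abs).continuousOn
      obtain ⟨x₀, hx₀, hmin⟩ := hCc.exists_isMinOn hCne hcont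
      have hpos : 0 < |f x₀ - a| := by
        rw [abs_pos, sub_ne_zero]
        intro heq
        exact h.not_isMCriticalPt heq hx₀.1
      refine ⟨min δ₀ (|f x₀ - a| / 2), lt_min hδ₀ (half_pos hpos), min_le_left _ _, fun x hx hcrit => ?_⟩
      have hxC : x ∈ C := ⟨hcrit, ⟨by linarith [hx.1, min_le_left δ₀ (|f x₀ - a| / 2)],
        by linarith [hx.2, min_le_left δ₀ (|f x₀ - a| / 2)]⟩⟩
      have h1 : |f x₀ - a| ≤ |f x - a| := hmin hxC
      have h2 : |f x - a| ≤ |f x₀ - a| / 2 := by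
        rw [abs_le]; constructor <;> linarith [hx.1, hx.2, min_le_right δ₀ (|f x₀ - a| / 2)]
      linarith
  -- a unit field on the thinner band
  have hBc : IsClosed (f ⁻¹' Icc (a - δ₁) (a + δ₁)) := isClosed_Icc.preimage hf.continuous
  obtain ⟨ξ₀, hξ₀⟩ := exists_contMDiffSection_mlineDeriv_eq_one_on hf hBc fun x hx => hreg x hx
  -- cut off by a bump function of `f`
  set δ : ℝ := δ₁ / 2 with hδ
  have hδp : 0 < δ := half_pos hδ₁
  let b : ContDiffBump a := ⟨δ, δ₁, hδp, by rw [hδ]; linarith⟩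
  set χ : M → ℝ := fun x => b (f x) with hχ
  have hχs : ContMDiff (𝓡 (n + 1)) 𝓘(ℝ, ℝ) ∞ χ := (b.contDiff.contMDiff).comp hf
  have hχ1 : ∀ x, f x ∈ Icc (a - δ) (a + δ) → χ x = 1 := fun x hx => by
    apply b.one_of_mem_closedBall
    rw [Metric.mem_closedBall, Real.dist_eq, abs_le]
    exact ⟨by linarith [hx.1], by linarith [hx.2]⟩
  have hχ0 : ∀ x, f x ∉ Icc (a - δ₁) (a + δ₁) → χ x = 0 := fun x hx => by
    apply b.zero_of_le_dist
    rw [Real.dist_eq]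
    by_contra hlt
    push Not at hlt
    rw [abs_lt] at hlt
    exact hx ⟨by linarith [hlt.1], by linarith [hlt.2]⟩
  refine ⟨⟨⟨fun x => χ x • ξ₀ x, hχs.smul_section ξ₀.contMDiff, hf, δ, hδp, fun x hx => ?_⟩,
    f ⁻¹' Icc (a - δ₁) (a + δ₁),
    hK.of_isClosed_subset hBc (preimage_mono (Icc_subset_Icc (by linarith) (by linarith))), fun x hx => ?_⟩⟩
  · show mlineDeriv (𝓡 (n + 1)) f x (χ x • ξ₀ x) = 1
    rw [mlineDeriv_smul, hχ1 x hx, one_mul]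
    exact hξ₀ x ⟨by linarith [hx.1], by linarith [hx.2]⟩
  · show χ x • ξ₀ x = 0
    rw [hχ0 x hx, zero_smul]

namespace BandUnitField

variable {f : M → ℝ} {a : ℝ} (U : BandUnitField n f a)

/-! ### The flow and the clock -/

/-- The global flow of the compactly supported field exists (Lee 2012, Thm. 9.16).
[cite: LeeSmoothManifolds2013, Thm. 9.16 and Thm. 9.12] -/
theorem exists_flow : ∃ θ : ℝ × M → M, ContMDiff (𝓘(ℝ, ℝ).prod (𝓡 (n + 1))) (𝓡 (n + 1)) ∞ θ ∧
    (∀ p, θ (0, p) = p) ∧ (∀ t s p, θ (t, θ (s, p)) = θ (t + s, p)) ∧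
    (∀ p, IsMIntegralCurve (fun t => θ (t, p)) U.ξ) ∧ ∀ p, U.ξ p = 0 → ∀ t, θ (t, p) = p :=
  Literature.Geometry.Manifold.exists_contMDiff_globalFlow_of_eq_zero_off_isCompact U.contMDiff (by simp)
    U.isCompact_K U.eq_zero_off

/-- The global flow of the field, `fl x t`. [cite: LeeSmoothManifolds2013, Thm. 9.16] -/
def fl (x : M) (t : ℝ) : M := U.exists_flow.choose (t, x)

/-- The flow starts at the given point. [cite: LeeSmoothManifolds2013, Thm. 9.12] -/
@[simp] theorem fl_zero (x : M) : U.fl x 0 = x := U.exists_flow.choose_spec.2.1 x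

/-- The group law of the flow. [cite: LeeSmoothManifolds2013, Thm. 9.12] -/
theorem fl_add (x : M) (s t : ℝ) : U.fl x (s + t) = U.fl (U.fl x s) t := by
  have := U.exists_flow.choose_spec.2.2.1 t s x
  rw [add_comm s t]
  exact this.symm

/-- The flow is smooth jointly in `(x, t)`. [cite: LeeSmoothManifolds2013, Thm. 9.12] -/
theorem contMDiff_fl : ContMDiff ((𝓡 (n + 1)).prod 𝓘(ℝ, ℝ)) (𝓡 (n + 1)) ∞ fun p : M × ℝ => U.fl p.1 p.2 :=
  U.exists_flow.choose_spec.1.comp (contMDiff_snd.prodMk contMDiff_fst)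

/-- The flow is continuous jointly in `(x, t)`. [cite: LeeSmoothManifolds2013, Thm. 9.12] -/
theorem continuous_fl : Continuous fun p : M × ℝ => U.fl p.1 p.2 := U.contMDiff_fl.continuous

/-- The flow lines are integral curves of the field. [cite: LeeSmoothManifolds2013, Thm. 9.12] -/
theorem isMIntegralCurve_fl (x : M) : IsMIntegralCurve (fun t => U.fl x t) U.ξ :=
  U.exists_flow.choose_spec.2.2.2.1 x

/-- Along a flow line, `t ↦ f (fl x t)` has derivative `ξ(f)` at the current point.
[cite: Milnor1963, proof of Thm. 3.1] -/
theorem hasDerivAt_comp_fl (x : M) (t : ℝ) :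
    HasDerivAt (fun t => f (U.fl x t)) (mlineDeriv (𝓡 (n + 1)) f (U.fl x t) (U.ξ (U.fl x t))) t :=
  hasDerivAt_comp_integralCurve U.contMDiff_f (U.isMIntegralCurve_fl x) t

/-- In the open band, the derivative of `t ↦ f (fl x t)` is `1`. [cite: Milnor1963, proof of Thm. 3.1] -/
theorem deriv_eq_one_of_mem_band (x : M) (t : ℝ) (ht : f (U.fl x t) ∈ Ioo (a - U.δ) (a + U.δ)) :
    mlineDeriv (𝓡 (n + 1)) f (U.fl x t) (U.ξ (U.fl x t)) = 1 :=
  U.mlineDeriv_eq_one _ ⟨ht.1.le, ht.2.le⟩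

/-- **The clock, forwards**: `f (fl x t) = f x + t` for `t ≥ 0` as long as the values stay in
the open band. [cite: Milnor1963, proof of Thm. 3.1] -/
theorem apply_fl_eq_add_of_nonneg {x : M} {t : ℝ} (ht : 0 ≤ t) (hx : a - U.δ < f x)
    (hxt : f x + t < a + U.δ) : f (U.fl x t) = f x + t := by
  have key := UnitSpeed.eq_add_of_deriv_eq_one (g := fun t => f (U.fl x t))
    (g' := fun t => mlineDeriv (𝓡 (n + 1)) f (U.fl x t) (U.ξ (U.fl x t)))
    (U.hasDerivAt_comp_fl x) (fun t ht => U.deriv_eq_one_of_mem_band x t ht) (t₀ := 0) (T := t)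
    (by simpa using hx) (by simpa using hxt) t ⟨ht, le_rfl⟩
  simpa using key

/-- **The clock, backwards**: `f (fl x t) = f x + t` for `t ≤ 0` as long as the values stay in
the open band (time reversal). [cite: Milnor1963, proof of Thm. 3.1] -/
theorem apply_fl_eq_add_of_nonpos {x : M} {t : ℝ} (ht : t ≤ 0) (hx : f x < a + U.δ)
    (hxt : a - U.δ < f x + t) : f (U.fl x t) = f x + t := by
  set g : ℝ → ℝ := fun t => f (U.fl x t) with hg
  set g' : ℝ → ℝ := fun t => mlineDeriv (𝓡 (n + 1)) f (U.fl x t) (U.ξ (U.fl x t)) with hg'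
  have hderiv : ∀ t, HasDerivAt g (g' t) t := U.hasDerivAt_comp_fl x
  have hband : ∀ t, g t ∈ Ioo (a - U.δ) (a + U.δ) → g' t = 1 := fun t ht => U.deriv_eq_one_of_mem_band x t ht
  have hGderiv := UnitSpeed.hasDerivAt_neg_comp_sub hderiv 0
  have hGband := UnitSpeed.band_neg_comp_sub hband 0
  have hg0 : g 0 = f x := by simp [hg]
  have key := UnitSpeed.eq_add_of_deriv_eq_one hGderiv hGband (t₀ := 0) (T := -t)
    (by simp only [sub_zero, hg0]; linarith) (by simp only [sub_zero, hg0]; linarith) (-t) ⟨by linarith, le_rfl⟩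
  simp only [zero_add, sub_zero, hg0, zero_sub, neg_neg] at key
  have : g t = f x + t := by linarith
  exact this

/-- **The clock**: `f (fl x t) = f x + t` whenever `f x` and `f x + t` both lie in the open band
`(a - U.δ, a + U.δ)`. [cite: Milnor1963, proof of Thm. 3.1] -/
theorem apply_fl_eq_add {x : M} {t : ℝ} (hx : f x ∈ Ioo (a - U.δ) (a + U.δ))
    (hxt : f x + t ∈ Ioo (a - U.δ) (a + U.δ)) : f (U.fl x t) = f x + t := by
  rcases le_total 0 t with ht | ht
  · exact U.apply_fl_eq_add_of_nonneg ht hx.1 hxt.2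
  · exact U.apply_fl_eq_add_of_nonpos ht hx.2 hxt.1

/-- From the level, the flow reaches height `a + s` at time `s ∈ (-δ, δ)`. [cite: MilnorHCobordism1965, proof of Thm. 3.4] -/
theorem apply_fl_of_apply_eq {y : M} (hy : f y = a) {s : ℝ} (hs : s ∈ Ioo (-U.δ) U.δ) :
    f (U.fl y s) = a + s := by
  have h := U.apply_fl_eq_add (x := y) (t := s)
    (by rw [hy]; exact ⟨by linarith [U.δ_pos], by linarith [U.δ_pos]⟩)
    (by rw [hy]; exact ⟨by linarith [hs.1], by linarith [hs.2]⟩)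
  rw [hy] at h
  exact h

/-! ### The open band and the drop onto the level -/

/-- The open band `f⁻¹(a - U.δ, a + U.δ)` around the level. [cite: Milnor1963, proof of Thm. 3.1] -/
def band : Set M := f ⁻¹' Ioo (a - U.δ) (a + U.δ)

omit [T2Space M] in
/-- Membership in the band (definitional). [folklore] -/
theorem mem_band_iff {x : M} : x ∈ U.band ↔ f x ∈ Ioo (a - U.δ) (a + U.δ) := Iff.rfl

omit [T2Space M] in
/-- The band is open. [folklore] -/
theorem isOpen_band : IsOpen U.band := isOpen_Ioo.preimage U.contMDiff_f.continuous

omit [T2Space M] in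
/-- The level lies in the band. [folklore] -/
theorem mem_band_of_apply_eq {y : M} (hy : f y = a) : y ∈ U.band := by
  rw [mem_band_iff, hy]; exact ⟨by linarith [U.δ_pos], by linarith [U.δ_pos]⟩

/-- The flow-out of the level for times in `(-δ, δ)` stays in the band. [cite: MilnorHCobordism1965, proof of Thm. 3.4] -/
theorem fl_mem_band {y : M} (hy : f y = a) {s : ℝ} (hs : s ∈ Ioo (-U.δ) U.δ) : U.fl y s ∈ U.band := by
  rw [mem_band_iff, U.apply_fl_of_apply_eq hy hs]
  exact ⟨by linarith [hs.1], by linarith [hs.2]⟩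

/-- **The drop onto the level** along the flow: `drop x = fl x (a - f x)`.
[cite: MilnorHCobordism1965, proof of Thm. 3.4] -/
def drop (x : M) : M := U.fl x (a - f x)

/-- The drop is smooth on all of `M`. [cite: MilnorHCobordism1965, proof of Thm. 3.4] -/
theorem contMDiff_drop : ContMDiff (𝓡 (n + 1)) (𝓡 (n + 1)) ∞ U.drop :=
  U.contMDiff_fl.comp (contMDiff_id.prodMk (contMDiff_const.sub U.contMDiff_f))

/-- The drop is continuous. [folklore] -/
theorem continuous_drop : Continuous U.drop := U.contMDiff_drop.continuous

/-- **From the band, the drop lands on the level**: `f (drop x) = a`. [cite: MilnorHCobordism1965, proof of Thm. 3.4] -/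
theorem apply_drop {x : M} (hx : x ∈ U.band) : f (U.drop x) = a := by
  rw [drop, U.apply_fl_eq_add hx (by rw [add_sub_cancel]; exact ⟨by linarith [U.δ_pos], by linarith [U.δ_pos]⟩)]
  ring

/-- On the level the drop is the identity. [cite: MilnorHCobordism1965, proof of Thm. 3.4] -/
theorem drop_of_apply_eq {y : M} (hy : f y = a) : U.drop y = y := by
  rw [drop, hy, sub_self, fl_zero]

/-- Flowing the drop back up for time `f x - a` returns `x`. [cite: MilnorHCobordism1965, proof of Thm. 3.4] -/
theorem fl_drop (x : M) : U.fl (U.drop x) (f x - a) = x := by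
  rw [drop, ← fl_add, show a - f x + (f x - a) = 0 by ring, fl_zero]

/-- **The drop is constant along the flow inside the band.** [cite: MilnorHCobordism1965, proof of Thm. 3.4] -/
theorem drop_fl {x : M} {t : ℝ} (hx : x ∈ U.band) (hxt : f x + t ∈ Ioo (a - U.δ) (a + U.δ)) :
    U.drop (U.fl x t) = U.drop x := by
  rw [drop, drop, U.apply_fl_eq_add hx hxt, ← fl_add]
  congr 1
  ring

/-- Dropping the flow-out of a point of the level returns that point. [cite: MilnorHCobordism1965, proof of Thm. 3.4] -/
theorem drop_fl_of_apply_eq {y : M} (hy : f y = a) {s : ℝ} (hs : s ∈ Ioo (-U.δ) U.δ) :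
    U.drop (U.fl y s) = y := by
  rw [U.drop_fl (U.mem_band_of_apply_eq hy) (by rw [hy]; exact ⟨by linarith [hs.1], by linarith [hs.2]⟩),
    U.drop_of_apply_eq hy]

/-- The drop maps the band onto the level. [cite: MilnorHCobordism1965, proof of Thm. 3.4] -/
theorem drop_mem_level {x : M} (hx : x ∈ U.band) : U.drop x ∈ f ⁻¹' {a} := U.apply_drop hx

/-- **The flow-out of the level is injective on `f⁻¹(a) × (-δ, δ)`.** [cite: MilnorHCobordism1965, proof of Thm. 3.4] -/
theorem fl_injOn : InjOn (fun p : M × ℝ => U.fl p.1 p.2) ((f ⁻¹' {a}) ×ˢ Ioo (-U.δ) U.δ) := by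
  rintro ⟨y, s⟩ ⟨hy, hs⟩ ⟨y', s'⟩ ⟨hy', hs'⟩ heq
  have hy₀ : f y = a := hy
  have hy₀' : f y' = a := hy'
  have hss : s = s' := by
    have h1 := U.apply_fl_of_apply_eq hy₀ hs
    have h2 := U.apply_fl_of_apply_eq hy₀' hs'
    have : f (U.fl y s) = f (U.fl y' s') := by rw [show U.fl y s = U.fl y' s' from heq]
    linarith
  subst hss
  have : U.drop (U.fl y s) = U.drop (U.fl y' s) := by rw [show U.fl y s = U.fl y' s from heq]
  rw [U.drop_fl_of_apply_eq hy₀ hs, U.drop_fl_of_apply_eq hy₀' hs] at this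
  rw [this]

/-- **The flow-out of `f⁻¹(a) × (-δ, δ)` is exactly the open band.** [cite: MilnorHCobordism1965, proof of Thm. 3.4] -/
theorem image_fl_eq_band : (fun p : M × ℝ => U.fl p.1 p.2) '' ((f ⁻¹' {a}) ×ˢ Ioo (-U.δ) U.δ) = U.band := by
  refine Subset.antisymm ?_ fun x hx => ?_
  · rintro _ ⟨⟨y, s⟩, ⟨hy, hs⟩, rfl⟩
    exact U.fl_mem_band hy hs
  · refine ⟨(U.drop x, f x - a), ⟨U.drop_mem_level hx, ?_⟩, U.fl_drop x⟩
    have h1 : a - U.δ < f x := hx.1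
    have h2 : f x < a + U.δ := hx.2
    exact ⟨by show -U.δ < f x - a; linarith, by show f x - a < U.δ; linarith⟩

/-! ### The product chart `f⁻¹(a) × (-δ, δ) ≅ f⁻¹(a - δ, a + δ)` -/

section Chart

variable (h : IsRegularLevel (𝓡 (n + 1)) f a)

open Classical in
/-- The drop, lifted to the level manifold `RegularLevel h` (junk off the band).
[cite: MilnorHCobordism1965, proof of Thm. 3.4] -/
def dropLift [Nonempty (RegularLevel h)] (x : M) : RegularLevel h :=
  if hx : f (U.drop x) = a then ⟨U.drop x, hx⟩ else Classical.arbitrary _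

/-- On the band, the lifted drop is the drop. [cite: MilnorHCobordism1965, proof of Thm. 3.4] -/
theorem incl_dropLift [Nonempty (RegularLevel h)] {x : M} (hx : x ∈ U.band) :
    RegularLevel.incl h (U.dropLift h x) = U.drop x := by
  have hx' : f (U.drop x) = a := U.apply_drop hx
  simp only [dropLift, hx', ↓reduceDIte]

/-- On the band, `incl ∘ dropLift = drop` eventually. [folklore] -/
theorem incl_comp_dropLift_eventuallyEq [Nonempty (RegularLevel h)] {x : M} (hx : x ∈ U.band) :
    (RegularLevel.incl h ∘ U.dropLift h) =ᶠ[𝓝 x] U.drop := by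
  filter_upwards [U.isOpen_band.mem_nhds hx] with z hz
  exact U.incl_dropLift h hz

/-- **The lifted drop is smooth on the band, as a map into the level manifold.**
[cite: MilnorHCobordism1965, proof of Thm. 3.4] -/
theorem contMDiffAt_dropLift [Nonempty (RegularLevel h)] {x : M} (hx : x ∈ U.band) :
    ContMDiffAt (𝓡 (n + 1)) (𝓡 n) ∞ (U.dropLift h) x := by
  have hι := RegularLevel.isSmoothEmbedding_incl h
  have hcomp : ContMDiffAt (𝓡 (n + 1)) (𝓡 (n + 1)) ∞ (RegularLevel.incl h ∘ U.dropLift h) x :=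
    U.contMDiff_drop.contMDiffAt.congr_of_eventuallyEq (U.incl_comp_dropLift_eventuallyEq h hx)
  have hcont : ContinuousAt (U.dropLift h) x := by
    rw [hι.isEmbedding.isInducing.continuousAt_iff]
    exact hcomp.continuousAt
  exact (ContMDiffAt.iff_comp_isImmersionAt (hι.isImmersion.isImmersionAt _)).2 ⟨hcont, hcomp⟩

/-- The lifted drop is smooth on the band. [cite: MilnorHCobordism1965, proof of Thm. 3.4] -/
theorem contMDiffOn_dropLift [Nonempty (RegularLevel h)] :
    ContMDiffOn (𝓡 (n + 1)) (𝓡 n) ∞ (U.dropLift h) U.band := fun _ hx =>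
  (U.contMDiffAt_dropLift h hx).contMDiffWithinAt

/-- **The product chart of the level** `(y, s) ↦ fl y s`, an open partial homeomorphism from
`f⁻¹(a) × ℝ` to `M` with source `f⁻¹(a) × (-δ, δ)` and target the open band.
[cite: MilnorHCobordism1965, Thm. 3.4 and its proof] -/
def collarChart [Nonempty (RegularLevel h)] : OpenPartialHomeomorph (RegularLevel h × ℝ) M where
  toFun p := U.fl (RegularLevel.incl h p.1) p.2
  invFun x := (U.dropLift h x, f x - a)
  source := univ ×ˢ Ioo (-U.δ) U.δ
  target := U.band
  map_source' p hp := U.fl_mem_band p.1.2 hp.2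
  map_target' x hx := by
    have h1 : a - U.δ < f x := hx.1
    have h2 : f x < a + U.δ := hx.2
    exact ⟨mem_univ _, show f x - a ∈ Ioo (-U.δ) U.δ from ⟨by linarith, by linarith⟩⟩
  left_inv' p hp := by
    obtain ⟨y, s⟩ := p
    have hy : f (RegularLevel.incl h y) = a := y.2
    have hs : s ∈ Ioo (-U.δ) U.δ := hp.2
    have h1 : U.dropLift h (U.fl (RegularLevel.incl h y) s) = y := by
      apply (RegularLevel.isEmbedding_incl h).injective
      rw [U.incl_dropLift h (U.fl_mem_band hy hs), U.drop_fl_of_apply_eq hy hs]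
    have h2 : f (U.fl (RegularLevel.incl h y) s) - a = s := by
      rw [U.apply_fl_of_apply_eq hy hs]; ring
    rw [Prod.mk.injEq]
    exact ⟨h1, h2⟩
  right_inv' x hx := by
    show U.fl (RegularLevel.incl h (U.dropLift h x)) (f x - a) = x
    rw [U.incl_dropLift h hx, U.fl_drop x]
  open_source := isOpen_univ.prod isOpen_Ioo
  open_target := U.isOpen_band
  continuousOn_toFun :=
    (U.continuous_fl.comp ((RegularLevel.isEmbedding_incl h).continuous.prodMap continuous_id)).continuousOn
  continuousOn_invFun :=
    (U.contMDiffOn_dropLift h).continuousOn.prodMk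
      ((U.contMDiff_f.continuous.sub continuous_const).continuousOn)

/-- The product chart, as a function (definitional). [cite: MilnorHCobordism1965, Thm. 3.4 and its proof] -/
theorem collarChart_apply [Nonempty (RegularLevel h)] (p : RegularLevel h × ℝ) :
    U.collarChart h p = U.fl (RegularLevel.incl h p.1) p.2 := rfl

/-- The inverse of the product chart, as a function (definitional). [cite: MilnorHCobordism1965, Thm. 3.4 and its proof] -/
theorem collarChart_symm_apply [Nonempty (RegularLevel h)] (x : M) :
    (U.collarChart h).symm x = (U.dropLift h x, f x - a) := rfl

/-- The source of the product chart (definitional). [cite: MilnorHCobordism1965, Thm. 3.4 and its proof] -/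
theorem collarChart_source [Nonempty (RegularLevel h)] :
    (U.collarChart h).source = univ ×ˢ Ioo (-U.δ) U.δ := rfl

/-- The target of the product chart (definitional). [cite: MilnorHCobordism1965, Thm. 3.4 and its proof] -/
theorem collarChart_target [Nonempty (RegularLevel h)] : (U.collarChart h).target = U.band := rfl

/-- **In the product chart, `f = a + s`.** [cite: MilnorHCobordism1965, Thm. 3.4 and its proof] -/
theorem apply_collarChart [Nonempty (RegularLevel h)] {p : RegularLevel h × ℝ}
    (hp : p ∈ (U.collarChart h).source) : f (U.collarChart h p) = a + p.2 :=
  U.apply_fl_of_apply_eq p.1.2 hp.2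

/-- **The product chart is smooth** (on all of `f⁻¹(a) × ℝ`). [cite: MilnorHCobordism1965, Thm. 3.4 and its proof] -/
theorem contMDiff_collarChart [Nonempty (RegularLevel h)] :
    ContMDiff ((𝓡 n).prod 𝓘(ℝ, ℝ)) (𝓡 (n + 1)) ∞ (U.collarChart h) :=
  U.contMDiff_fl.comp ((RegularLevel.contMDiff_incl h).prodMap contMDiff_id)

/-- The product chart is smooth on its source. [cite: MilnorHCobordism1965, Thm. 3.4 and its proof] -/
theorem contMDiffOn_collarChart [Nonempty (RegularLevel h)] :
    ContMDiffOn ((𝓡 n).prod 𝓘(ℝ, ℝ)) (𝓡 (n + 1)) ∞ (U.collarChart h) (U.collarChart h).source :=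
  (U.contMDiff_collarChart h).contMDiffOn

/-- **The inverse of the product chart is smooth on the band.** [cite: MilnorHCobordism1965, Thm. 3.4 and its proof] -/
theorem contMDiffOn_collarChart_symm [Nonempty (RegularLevel h)] :
    ContMDiffOn (𝓡 (n + 1)) ((𝓡 n).prod 𝓘(ℝ, ℝ)) ∞ (U.collarChart h).symm (U.collarChart h).target :=
  (U.contMDiffOn_dropLift h).prodMk ((U.contMDiff_f.sub contMDiff_const).contMDiffOn)

end Chart

end BandUnitField

/-- **The product neighbourhood theorem for a regular level with compact band** (Milnor 1963,
Thm. 3.1; Milnor 1965, Thm. 3.4; non-compact manifold, compact band): if `f` is smooth on the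
Hausdorff σ-compact manifold without boundary `M`, the level `f⁻¹(a)` carries no critical point
and is nonempty, and some closed band `f⁻¹[a - δ₀, a + δ₀]` (`δ₀ > 0`) is compact, then for some
`δ > 0` there is an open partial homeomorphism `Φ` from `f⁻¹(a) × ℝ` to `M` with source
`f⁻¹(a) × (-δ, δ)` and target the open band `f⁻¹(a - δ, a + δ)`, `C^∞` with `C^∞` inverse,
restricting to the inclusion on `f⁻¹(a) × {0}` and with `f (Φ (y, s)) = a + s`.
[cite: Milnor1963, Thm. 3.1] [cite: MilnorHCobordism1965, Thm. 3.4 and its proof] -/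
theorem IsRegularLevel.exists_collarChart_of_isCompact_band [SigmaCompactSpace M] {f : M → ℝ} {a : ℝ}
    (h : IsRegularLevel (𝓡 (n + 1)) f a) [Nonempty (RegularLevel h)] {δ₀ : ℝ} (hδ₀ : 0 < δ₀)
    (hK : IsCompact (f ⁻¹' Icc (a - δ₀) (a + δ₀))) :
    ∃ (δ : ℝ) (Φ : OpenPartialHomeomorph (RegularLevel h × ℝ) M), 0 < δ ∧
      Φ.source = univ ×ˢ Ioo (-δ) δ ∧ Φ.target = f ⁻¹' Ioo (a - δ) (a + δ) ∧
      ContMDiffOn ((𝓡 n).prod 𝓘(ℝ, ℝ)) (𝓡 (n + 1)) ∞ Φ Φ.source ∧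
      ContMDiffOn (𝓡 (n + 1)) ((𝓡 n).prod 𝓘(ℝ, ℝ)) ∞ Φ.symm Φ.target ∧
      (∀ y : RegularLevel h, Φ (y, 0) = RegularLevel.incl h y) ∧
      ∀ p ∈ Φ.source, f (Φ p) = a + p.2 := by
  obtain ⟨U⟩ := h.exists_bandUnitField hδ₀ hK
  exact ⟨U.δ, U.collarChart h, U.δ_pos, rfl, rfl, U.contMDiffOn_collarChart h,
    U.contMDiffOn_collarChart_symm h, fun y => U.fl_zero _, fun p hp => U.apply_collarChart h hp⟩

end Literature.Topology.FourManifolds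

end
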